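import Summits.ABC.IUTFork.Conditional.WRowUnconditionalCellsBase
import HarnessLib

/-!
# R-W window sockets — the integer cell at a PINNED index from its two end labels, for ANY different input `D` and ANY inner radius `R`
# (pure arithmetic; companion of abc-iut-W-row-1's `WRowUnconditionalCellsBase`)

PROOF-ONLY file (D-0012; 0 definitions, 0 `Prop` facts; integer arithmetic only) of the abc-iut cell — D-0079 RESCUE sub-cell R-W «WINDOW Θ-SIDE
INEQUALITY», numerics-crew seat abc-iut-W-num-6 (gen 5), item «W2-EXACT-DIFFERENT INH» (abc-iut-plan g12 C-R111 (b) / C-R112 (b)). abc-iut-W-row-1's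
`WRow.cell_wild_of_ends` / `WRow.cell_tameslot_of_ends` hard-wire the different input (`D = 2e − 1` / `D = e·n − 1`) because they serve every multiple
`e = e₀·n` of a base index; at a pole whose local type is PINNED by a theorem (abc-iut-W-neg-2's exact wild types) only ONE index `e` occurs, and then the
cell `e·⌊(j²P − j·D − (j+1)·R)/e⌋ + (j+1)·min(p^A − A·e, p^B − B·e) ≤ P` follows for every label `1 ≤ j ≤ L` from the FLOOR-FREE cell with the first
member at the two end labels `j = 1`, `j = L` — whatever the naturals `D` (different input) and `R` (inner radius) are: drop the floor
(`Int.mul_ediv_self_le`), bound the `min` by its first member, and use convexity in `j` (abc-iut-W-row-1's `WRow.quad_nonpos_of_ends`). Consumer: the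
different-hook socket `Cor312LicenceTripleLocalTypeSlotDiff` with the W2-EXACT different `D = e + e/p − 1` (abc-iut-w5-d180's
`GenuineK.differentOrd_kOf_eq_wildUnit_of_triple`). HONEST SCOPE: integer arithmetic only; nothing here bears on the printed inequality of
[IUTchIII] Cor. 3.12; no abc claim. [folklore]
-/

namespace Summit.ABC.IUTFork.Conditional

/-- **The socket cell at a pinned index from the two end labels, any `D`, any `R`.** If the floor-free cell with the first envelope member,
`j²·P − j·D − (j+1)·R + (j+1)·(p^A − A·e) ≤ P`, holds at `j = 1` and at `j = L` (`i = 0`, `i + 1 = L`), then the exact cell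
`e·⌊(j²P − j·D − (j+1)·R)/e⌋ + (j+1)·min(p^A − A·e, p^B − B·e) ≤ P` holds at every label `j = i + 1 ≤ L` (convexity: leading coefficient `P ≥ 0`).
[folklore] -/
theorem RefBand.cell_pinned_of_ends (p : ℤ) (e P D R A B L : ℕ) (he : 0 < e)
    (hends : ∀ i : ℕ, i = 0 ∨ i + 1 = L →
      ((i + 1 : ℕ) : ℤ) ^ 2 * (P : ℤ) - ((i + 1 : ℕ) : ℤ) * (D : ℤ) - ((i + 2 : ℕ) : ℤ) * (R : ℤ) +
        ((i + 2 : ℕ) : ℤ) * (p ^ A - (A : ℤ) * (e : ℤ)) ≤ (P : ℤ))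
    {i : ℕ} (hi : i < L) :
    (e : ℤ) * ((((i + 1 : ℕ) : ℤ) ^ 2 * (P : ℤ) - ((i + 1 : ℕ) : ℤ) * (D : ℤ) - ((i + 2 : ℕ) : ℤ) * (R : ℤ)) / (e : ℤ)) +
      ((i + 2 : ℕ) : ℤ) * min (p ^ A - (A : ℤ) * (e : ℤ)) (p ^ B - (B : ℤ) * (e : ℤ)) ≤ (P : ℤ) := by
  have he' : (0 : ℤ) < (e : ℤ) := by exact_mod_cast he
  have hfloor := Int.mul_ediv_self_le (k := (e : ℤ))
    (x := ((i + 1 : ℕ) : ℤ) ^ 2 * (P : ℤ) - ((i + 1 : ℕ) : ℤ) * (D : ℤ) - ((i + 2 : ℕ) : ℤ) * (R : ℤ)) he'.ne'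
  have hmin : min (p ^ A - (A : ℤ) * (e : ℤ)) (p ^ B - (B : ℤ) * (e : ℤ)) ≤ p ^ A - (A : ℤ) * (e : ℤ) := min_le_left _ _
  have hJ : (0 : ℤ) ≤ ((i + 2 : ℕ) : ℤ) := by positivity
  have hJm := mul_le_mul_of_nonneg_left hmin hJ
  have h1 := hends 0 (Or.inl rfl)
  have hL := hends (L - 1) (Or.inr (by omega))
  have hc1 : ((L - 1 + 1 : ℕ) : ℤ) = (L : ℤ) := by rw [Nat.sub_add_cancel (by omega)]
  have hc2 : ((L - 1 + 2 : ℕ) : ℤ) = (L : ℤ) + 1 := by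
    rw [show L - 1 + 2 = L + 1 by omega]; push_cast; ring
  rw [hc1, hc2] at hL
  have q := WRow.quad_nonpos_of_ends (P : ℤ) (-(D : ℤ) - (R : ℤ) + (p ^ A - (A : ℤ) * (e : ℤ)))
    (-(R : ℤ) + (p ^ A - (A : ℤ) * (e : ℤ)) - (P : ℤ)) L (by positivity)
    (by push_cast at h1 ⊢; linarith) (by linarith) (i + 1) (by omega) (by omega)
  generalize ((((i + 1 : ℕ) : ℤ) ^ 2 * (P : ℤ) - ((i + 1 : ℕ) : ℤ) * (D : ℤ) - ((i + 2 : ℕ) : ℤ) * (R : ℤ)) / (e : ℤ)) = Q at hfloor ⊢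
  generalize min (p ^ A - (A : ℤ) * (e : ℤ)) (p ^ B - (B : ℤ) * (e : ℤ)) = m at hJm ⊢
  push_cast at hfloor hJm q ⊢
  nlinarith [hfloor, hJm, q]

end Summit.ABC.IUTFork.Conditional
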